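import Summits.NavierStokesRegularity.NavierStokesRegularity.Theorems.CertifiedBlowupCertifiedBlowupAxisymBlowupNormalForm
import Mathlib.Data.Real.Pointwise
import HarnessLib

/-!
# Crux `CertifiedBlowupAxisymBlowup` (stmt-NavierStokesRegularity-0727): the swirl Reynolds number is a pure number

Summit `NavierStokesRegularity`, thesis `CertifiedBlowup`, crux `CertifiedBlowupAxisymBlowup`.
Theorems file landed `--supports stmt-NavierStokesRegularity-0727` for line `compact-amplification`
(continuation lead c3, wave 1; stub `swirlNumberSet_eq`, bet route `SwirlThreshold`).

Route `SwirlThreshold` studies the swirl threshold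
`Re_c := ν⁻¹ · inf { sup_x |Γ(u(t), x)| : (u, p, T) a witness of the crux at viscosity ν, t ∈ [0, T) }`,
`Γ = r u_θ = x₀ u₁ − x₁ u₀` the swirl (KNSS 2009, (1.8); Lei–Zhang 2017, §1: `Γ` is scaling
critical). This file proves, kernel-checked, that the SET of swirl Reynolds numbers
`sup_x |Γ(u(t), x)| / ν` realised by witnesses of the crux at viscosity `ν` does not depend on `ν`
(`swirlNumberSet_eq`, registered stub), so that `Re_c` is a pure number. Mechanism: the viscosity
scaling `v(s, x) = c u(c s, x)` with `c = ν'/ν` (Tao 2011, footnote 3) carries witnesses at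
viscosity `ν` to witnesses at viscosity `ν'` (tree: `isMaximalSmoothSolution_timeRescale`,
`IsLerayHopfOn.viscosityRescale`, `hasRapidSpatialDecay_const_smul`, `isAxisymmetric_const_smul`,
all as in the landed normal form `certifiedBlowupAxisymBlowup_iff_forall_nu_T`), and the swirl is
linear in the field, so `sup_x |Γ(v(s), x)| = c · sup_x |Γ(u(c s), x)|`
(`sSup_abs_swirl_timeRescale`) and the quotient by the viscosity is unchanged. As a complement,
`sup_x |Γ|` itself is invariant under Leray's similarity `w(s, y) = c u(c² s, c y)`
(`sSup_abs_swirl_nsRescale`): the swirl supremum is scale invariant.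

No new definitions, no named-fact hypotheses, no `sorry`.

## References

* T. Tao, *Localisation and compactness properties of the Navier–Stokes global regularity
  problem*, Anal. PDE 6 (2013), footnote 3 (viscosity normalisation). [Tao2011]
* Z. Lei, Q. S. Zhang, *Criticality of the axially symmetric Navier–Stokes equations*, Pacific J.
  Math. 289 (2017), §1 (criticality of `Γ`). [LeiZhang2017]
* G. Koch, N. Nadirashvili, G. Seregin, V. Šverák, *Liouville theorems for the Navier–Stokes
  equations and applications*, Acta Math. 203 (2009), (1.8). [KNSS2009]
* J. Leray, *Sur le mouvement d'un liquide visqueux emplissant l'espace*, Acta Math. 63 (1934),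
  §20 (the similarity transformation). [Leray1934]
-/

-- the summit and its single problem share the name (D-0017 nested layout)
set_option linter.dupNamespace false

noncomputable section

open MeasureTheory Set Function Filter Topology Metric
open scoped ENNReal NNReal

namespace Summit.NavierStokesRegularity.NavierStokesRegularity.Theorems.CertifiedBlowupAxisymBlowup.CompactAmplification

open Literature.Analysis.FluidPDE
open Summit.NavierStokesRegularity.NavierStokesRegularity.Theorems.SwirlSupStrictDecrease
  (swirl_const_smul isAxisymmetric_const_smul)

/-! ### The swirl under the two scalings -/

/-- **The swirl supremum under the viscosity scaling**: for `c ≥ 0` the slice at time `s` of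
`v = timeRescale c c u` (`v(s, x) = c u(c s, x)`, Tao 2011, fn. 3) has swirl `Γ(v(s)) = c Γ(u(c s))`
(the swirl `Γ = x₀ u₁ − x₁ u₀` is linear in the field), hence
`sup_x |Γ(v(s), x)| = c · sup_x |Γ(u(c s), x)|` (no boundedness needed: `Real.sSup_smul_of_nonneg`).
[cite: Tao2011, footnote 3] -/
theorem sSup_abs_swirl_timeRescale {c : ℝ} (hc : 0 ≤ c)
    (u : ℝ → EuclideanSpace ℝ (Fin 3) → EuclideanSpace ℝ (Fin 3)) (s : ℝ) :
    sSup (Set.range fun x => |swirl (timeRescale c c u s) x|) =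
      c * sSup (Set.range fun x => |swirl (u (c * s)) x|) := by
  have hslice : timeRescale c c u s = c • u (c * s) := by
    funext x
    rw [timeRescale_apply, Pi.smul_apply]
  have hfun : (fun x => |swirl (timeRescale c c u s) x|) = fun x => c • |swirl (u (c * s)) x| := by
    funext x
    rw [hslice, swirl_const_smul, abs_mul, abs_of_nonneg hc, smul_eq_mul]
  rw [hfun, Set.range_smul, Real.sSup_smul_of_nonneg hc, smul_eq_mul]

/-- **The swirl under Leray's similarity** `w(t, x) = c u(c² t, c x)` (`nsRescale c u`, Leray
1934, §20): `Γ(w(t), x) = Γ(u(c² t), c x)` — the factor `c` of the amplitude is absorbed by the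
factor `c⁻¹` of `r`, i.e. `Γ = r u_θ` is dimensionless (KNSS 2009, (1.8)). [cite: KNSS2009, (1.8)] -/
theorem swirl_nsRescale (c : ℝ) (u : ℝ → EuclideanSpace ℝ (Fin 3) → EuclideanSpace ℝ (Fin 3))
    (t : ℝ) (x : EuclideanSpace ℝ (Fin 3)) :
    swirl (nsRescale c u t) x = swirl (u (c ^ 2 * t)) (c • x) := by
  simp only [swirl, nsRescale_apply, PiLp.smul_apply, smul_eq_mul]
  ring

/-- **The swirl supremum is invariant under Leray's similarity**: for `c ≠ 0` the slice at time
`t` of `w = nsRescale c u` has the same set of values `|Γ|`, hence the same `sup_x |Γ|`, as the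
slice of `u` at time `c² t` (`x ↦ c x` is onto) (Leray 1934, §20; KNSS 2009, (1.8)). [cite: KNSS2009, (1.8)] -/
theorem sSup_abs_swirl_nsRescale {c : ℝ} (hc : c ≠ 0)
    (u : ℝ → EuclideanSpace ℝ (Fin 3) → EuclideanSpace ℝ (Fin 3)) (t : ℝ) :
    sSup (Set.range fun x => |swirl (nsRescale c u t) x|) =
      sSup (Set.range fun x => |swirl (u (c ^ 2 * t)) x|) := by
  have h : (fun x => |swirl (nsRescale c u t) x|) =
      (fun y => |swirl (u (c ^ 2 * t)) y|) ∘ fun x : EuclideanSpace ℝ (Fin 3) => c • x := by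
    funext x
    rw [Function.comp_apply, swirl_nsRescale]
  rw [h, (MulAction.surjective₀ (α := EuclideanSpace ℝ (Fin 3)) hc).range_comp]

/-! ### Transfer of swirl Reynolds numbers between viscosities -/

/-- The viscosity scaling `v(s, x) = c u(c s, x)`, `c > 0`, `c ν = ν'`, carries a witness
`(T, u, p)` of the crux at viscosity `ν` to the witness `(T / c, v, c² p(c ·, ·))` at viscosity `ν'`
(exactly as in `exists_witness_timeRescale`) and the time `t ∈ [0, T)` to `t / c ∈ [0, T / c)`,
with `sup |Γ(v(t / c))| / ν' = c · sup |Γ(u(t))| / (c ν) = sup |Γ(u(t))| / ν`: every swirl Reynolds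
number realised at viscosity `ν` is realised at viscosity `ν'` (Tao 2011, fn. 3). [cite: Tao2011, footnote 3] -/
private theorem swirlNumber_transfer {ν ν' c : ℝ} (hc : 0 < c) (hcν : c * ν = ν') {R : ℝ}
    (hR : ∃ (T : ℝ) (u : ℝ → EuclideanSpace ℝ (Fin 3) → EuclideanSpace ℝ (Fin 3))
      (p : ℝ → EuclideanSpace ℝ (Fin 3) → ℝ), 0 < T ∧ IsMaximalSmoothSolution ν 0 u p T ∧
      IsLerayHopfOn T ν 0 (u 0) u ∧ HasRapidSpatialDecay (u 0) ∧ IsAxisymmetric (u 0) ∧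
      ∃ t ∈ Set.Ico 0 T, R = sSup (Set.range fun x => |swirl (u t) x|) / ν) :
    ∃ (T : ℝ) (u : ℝ → EuclideanSpace ℝ (Fin 3) → EuclideanSpace ℝ (Fin 3))
      (p : ℝ → EuclideanSpace ℝ (Fin 3) → ℝ), 0 < T ∧ IsMaximalSmoothSolution ν' 0 u p T ∧
      IsLerayHopfOn T ν' 0 (u 0) u ∧ HasRapidSpatialDecay (u 0) ∧ IsAxisymmetric (u 0) ∧
      ∃ t ∈ Set.Ico 0 T, R = sSup (Set.range fun x => |swirl (u t) x|) / ν' := by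
  subst hcν
  obtain ⟨T, u, p, hT, hmax, hLH, hdec, hax, t, ht, rfl⟩ := hR
  have hv0 : c • u 0 = timeRescale c c u 0 := by
    funext x
    rw [Pi.smul_apply, timeRescale_apply, mul_zero]
  refine ⟨T / c, timeRescale c c u, timeRescale c (c ^ 2) p, div_pos hT hc,
    isMaximalSmoothSolution_timeRescale hmax hc, ?_, ?_, ?_, t / c,
    ⟨div_nonneg ht.1 hc.le, div_lt_div_of_pos_right ht.2 hc⟩, ?_⟩
  · have h := hLH.viscosityRescale hc
    rwa [timeRescale_zero_force, hv0] at h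
  · rw [← hv0]
    exact SereginSverak2002_pressureOneSidedBound.hasRapidSpatialDecay_const_smul
      (hmax.1.contDiff_velocity ⟨le_rfl, hT⟩) hdec c
  · rw [← hv0]
    exact isAxisymmetric_const_smul c hax
  · rw [sSup_abs_swirl_timeRescale hc.le, mul_div_cancel₀ t hc.ne', mul_div_mul_left _ _ hc.ne']

/-! ### The registered stub -/

/-- **The swirl Reynolds number is a pure number** (registered stub of
stmt-NavierStokesRegularity-0727, line `compact-amplification`, route `SwirlThreshold`): for any two
viscosities `ν, ν' > 0`, the set of swirl Reynolds numbers `sup_x |Γ(u(t), x)| / ν`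
(`Γ = r u_θ = x₀ u₁ − x₁ u₀`, KNSS 2009, (1.8)) realised at times `t ∈ [0, T)` by witnesses
`(T, u, p)` of the crux `CertifiedBlowupAxisymBlowup` at viscosity `ν` (maximal classical solution
on `[0, T)`, Leray–Hopf from a rapidly decaying axisymmetric datum) coincides with the one at
viscosity `ν'`; in particular their infima, the swirl thresholds `Re_c(ν)`, agree. Both inclusions
are the viscosity scaling `v(s, x) = c u(c s, x)`, `c = ν'/ν` resp. `ν/ν'` (Tao 2011, fn. 3), under
which `sup |Γ|` is multiplied by `c` (Lei–Zhang 2017, §1: `Γ` is critical). [cite: Tao2011, footnote 3] -/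
theorem swirlNumberSet_eq : ∀ ν ν' : ℝ, 0 < ν → 0 < ν' → {R : ℝ | ∃ (T : ℝ) (u : ℝ → EuclideanSpace ℝ (Fin 3) → EuclideanSpace ℝ (Fin 3)) (p : ℝ → EuclideanSpace ℝ (Fin 3) → ℝ), 0 < T ∧ IsMaximalSmoothSolution ν 0 u p T ∧ IsLerayHopfOn T ν 0 (u 0) u ∧ HasRapidSpatialDecay (u 0) ∧ IsAxisymmetric (u 0) ∧ ∃ t ∈ Set.Ico 0 T, R = sSup (Set.range fun x => |swirl (u t) x|) / ν} = {R : ℝ | ∃ (T : ℝ) (u : ℝ → EuclideanSpace ℝ (Fin 3) → EuclideanSpace ℝ (Fin 3)) (p : ℝ → EuclideanSpace ℝ (Fin 3) → ℝ), 0 < T ∧ IsMaximalSmoothSolution ν' 0 u p T ∧ IsLerayHopfOn T ν' 0 (u 0) u ∧ HasRapidSpatialDecay (u 0) ∧ IsAxisymmetric (u 0) ∧ ∃ t ∈ Set.Ico 0 T, R = sSup (Set.range fun x => |swirl (u t) x|) / ν'} := by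
  intro ν ν' hν hν'
  ext R
  exact ⟨fun h => swirlNumber_transfer (div_pos hν' hν) (div_mul_cancel₀ ν' hν.ne') h,
    fun h => swirlNumber_transfer (div_pos hν hν') (div_mul_cancel₀ ν hν'.ne') h⟩

end Summit.NavierStokesRegularity.NavierStokesRegularity.Theorems.CertifiedBlowupAxisymBlowup.CompactAmplification

end
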